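import Literature.Analysis.FluidPDE.HeatDuhamelEnergy
import Literature.Analysis.FluidPDE.HeatDuhamelSmooth
import Literature.Analysis.FluidPDE.NSGaldiExtendedTest
import Mathlib.Analysis.SpecialFunctions.SmoothTransition
import HarnessLib

/-!
# The vorticity-duality identity for `L⁴(Q_T)` distributional Navier–Stokes solutions

Analysis/FluidPDE support file in the discharge programme of the named fact
`Literature.Analysis.FluidPDE.galdi_energy_equality` (Galdi 2019, Proc. AMS 147, Thm. 1.1), layer
`Literature.Analysis.FluidPDE.galdi_lerayHopf_class` (`NSGaldiEnergyEquality.lean`): a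
distributional solution `v ∈ L⁴(0,T; L⁴)` of the unforced Navier–Stokes system with datum
`v₀ ∈ L²_σ` lies in `L^∞(0,T; L²) ∩ L²(0,T; H¹)`. Galdi proves this by duality with the adjoint
(time-reversed, mollified-drift Oseen) problem. The tree's proof replaces the adjoint Oseen
problem by the adjoint **heat** problem, whose solution is the explicit backward caloric Duhamel
integral `𝒰[Φ]` of the accepted `Literature/Analysis/FluidPDE/HeatDuhamelBack` (`∂ₛ𝒰[Φ] + νΔ𝒰[Φ]
= -Φ`, `𝒰[Φ](s) = 0` past the time support of `Φ`), and moves the convection term to the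
right-hand side. No pressure enters because the test data are **curl-type fields**
`Φ = (∂ₐθ) c - (∂_cθ) a` of scalar test functions `θ`: then `𝒰[Φ] = (∂ₐ𝒰[θ]) c - (∂_c𝒰[θ]) a`
is again of curl type, hence divergence free, and the extension theorem
`IsWeakNSSolutionOn.weakForm_curlPair_extended_prod` (`NSGaldiExtendedTest.lean`) makes it an
admissible test field although it is not compactly supported in space.

## Main result

* `Literature.Analysis.FluidPDE.IsWeakNSSolutionOn.integral_inner_curlPair_eq`: for `ν > 0`, `v` a
  weak (pressure-free, divergence-free-tested) solution on `E × [0,T)` with datum `v₀ ∈ L²`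
  (`IsWeakNSSolutionOn T ν 0 v₀ v`) and `v ∈ L⁴` of the slab `(0,T) × E`, `θ` a scalar
  space–time test function with `θ(t) = 0` for `t ≥ b`, `b < T`, `a c : E`,
  `Φ = (∂ₐθ) c - (∂_cθ) a` and `U = 𝒰[Φ]`:
  `∫_{(0,T)×E} ⟪v, Φ⟫ = ∫_{(0,T)×E} ⟪v, (v·∇)U⟫ + ∫ ⟪v₀, U(0)⟫`.
  Pairing `v` with all such `Φ` determines the vorticity `∂ₐv_c - ∂_cv_a` of the (weakly
  divergence-free) field `v`, whence the name; the right-hand side is controlled by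
  `‖v‖²_{L⁴(Q_T)} ‖∇U‖_{L²(Q_T)} + ‖v₀‖₂ ‖U(0)‖₂`, i.e. by the `L²` energy and maximal-regularity
  estimates of `HeatDuhamelEnergy` (this quantitative step is the business of the next file of
  the programme).

Supporting lemmas (all proved): continuous linear maps commute with `𝒰`
(`IsSpaceTimeTestOn.heatDuhamelBack_clm_apply`); `𝒰` of test data lies in every `L^r`,
`1 ≤ r < ∞`, of the slab `(0,T) × E` (`IsSpaceTimeTestOn.eLpNorm_heatDuhamelBack_slab_lt_top`:
bounded with uniformly bounded `L¹` slices); the norms of the iterated spatial derivatives of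
`𝒰[Θ](s)` of orders `1, 2, 3` are those of `𝒰` of the nested derivatives of the data; the time
cut-off `ζ(t) = smoothTransition (t + 2)` (`= 1` for `t ≥ -1`, `= 0` for `t ≤ -2`) making
`ζ 𝒰[θ]` compactly supported in time without changing anything on `t ≥ -1`.

## Proof of the identity

Apply the extension theorem to the scalar potential `Ψ = ζ 𝒰[θ]`: its hypotheses (joint
smoothness, time support in `[-2, b]`, `DᵏΨ ∈ L^{4/3} ∩ L²` of the slab, `Dᵏ∂ₜΨ ∈ L^{4/3}`,
`Ψ(0), DΨ(0) ∈ L²`) hold because on `t ≥ -1` all these fields are Duhamel integrals of test data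
(derivatives fall on the data). The resulting field is `ψ = ζ U`, and on the slab `ψ = U`,
`∂ₜψ = 𝒰[∂ₜΦ]`, `Δψ = 𝒰[ΔΦ]`, so `⟪v, ∂ₜψ⟫ + ν⟪v, Δψ⟫ = -⟪v, Φ⟫` by the backward heat
equation; rearranging the extended weak formulation gives the identity. No new definitions.

## Mathlib / tree search

Mathlib (this pin): `Real.smoothTransition`, `ContinuousLinearMap.integral_comp_comm`,
`eLpNorm_congr_norm_ae`, `norm_iteratedFDeriv_fderiv`; no heat semigroup. From the tree:
`HeatDuhamelBack` (`fderiv_heatDuhamelBack`, `deriv_heatDuhamelBack_time`,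
`laplacian_heatDuhamelBack`, `heatDuhamelBack_backward_heat`, `norm_heatDuhamelBack_le`,
`integral_norm_heatDuhamelBack_le`, `memLp_two_heatDuhamelBack`), `HeatDuhamelSmooth`
(`contDiff_uncurry_heatDuhamelBack_infty`), `UnboundedOperators.heatExtension_clm_comp`,
`NSGaldiExtendedTest` (the extension theorem and its Hölder tools).

## References

* G. P. Galdi, *On the energy equality for distributional solutions to Navier–Stokes equations*,
  Proc. Amer. Math. Soc. 147 (2019), 785–792 (arXiv:1710.05725), proof of Thm. 1.1, (2.10)–(2.12)
  (duality with the adjoint problem). Bib key `Galdi2018`.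
* P. G. Lemarié-Rieusset, *The Navier–Stokes problem in the 21st century*, CRC Press 2016,
  Prop. 4.3 (the backward Duhamel integral and its energy estimates). Bib key
  `LemarieRieusset2016`.
-/

noncomputable section

open MeasureTheory TopologicalSpace Set Function Filter Topology InnerProductSpace Metric
open scoped RealInnerProductSpace ENNReal NNReal ContDiff Laplacian

namespace Literature.Analysis.FluidPDE

variable {E : Type*} [NormedAddCommGroup E] [InnerProductSpace ℝ E] [FiniteDimensional ℝ E]
  [MeasurableSpace E] [BorelSpace E]
variable {F : Type*} [NormedAddCommGroup F] [NormedSpace ℝ F] [CompleteSpace F]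

/-- Local notation (as in `NSGaldiExtendedTest`): the linear map `ℓ ↦ ℓ a • c - ℓ c • a`. -/
local notation3 "𝐋[" a ", " c "]" =>
  ((ContinuousLinearMap.apply ℝ ℝ a).smulRight c - (ContinuousLinearMap.apply ℝ ℝ c).smulRight a :
    (E →L[ℝ] ℝ) →L[ℝ] E)

/-! ### Complements on the backward caloric Duhamel integral of test data -/

section Duhamel

variable {ν : ℝ} {Θ : ℝ → E → F}

/-- **Continuous linear maps commute with the Duhamel integral**:
`𝒰[L ∘ Θ](s)(x) = L (𝒰[Θ](s)(x))`. [folklore] -/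
theorem IsSpaceTimeTestOn.heatDuhamelBack_clm_apply {G : Type*} [NormedAddCommGroup G]
    [NormedSpace ℝ G] [CompleteSpace G] (hΘ : IsSpaceTimeTestOn (⊤ : Opens (ℝ × E)) Θ)
    (hν : 0 < ν) (L : F →L[ℝ] G) (s : ℝ) (x : E) :
    heatDuhamelBack ν (fun t y => L (Θ t y)) s x = L (heatDuhamelBack ν Θ s x) := by
  rw [heatDuhamelBack_apply, heatDuhamelBack_apply,
    ← L.integral_comp_comm (hΘ.integrableOn_duhamelIntegrand hν s x)]
  refine setIntegral_congr_fun measurableSet_Ioi fun σ _ => ?_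
  exact UnboundedOperators.heatExtension_clm_comp L ((hΘ.contDiff_slice (s + σ)).continuous)
    (hΘ.hasCompactSupport_slice (s + σ)) (ν * σ) x

omit [FiniteDimensional ℝ E] [MeasurableSpace E] [BorelSpace E] [CompleteSpace F] in
/-- A continuous linear image of a space–time test field is a space–time test field. [folklore] -/
theorem IsSpaceTimeTestOn.clm_apply_top {G : Type*} [NormedAddCommGroup G] [NormedSpace ℝ G]
    (hΘ : IsSpaceTimeTestOn (⊤ : Opens (ℝ × E)) Θ) (L : F →L[ℝ] G) :
    IsSpaceTimeTestOn (⊤ : Opens (ℝ × E)) (fun t y => L (Θ t y)) where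
  contDiff := L.contDiff.comp hΘ.contDiff
  hasCompactSupport := hΘ.hasCompactSupport.comp_left (map_zero L)
  tsupport_subset := by simp

omit [FiniteDimensional ℝ E] [MeasurableSpace E] [BorelSpace E] [CompleteSpace F] in
/-- The time support of a test field shrinks to `[a, b]` when the field also vanishes for
`t ≥ b`. [folklore] -/
theorem IsSpaceTimeTestOn.exists_time_support_of_le
    (hΘ : IsSpaceTimeTestOn (⊤ : Opens (ℝ × E)) Θ) {b : ℝ} (hb : ∀ t, b ≤ t → Θ t = 0) :
    ∃ a : ℝ, ∀ t, t ∉ Icc a b → Θ t = 0 := by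
  obtain ⟨a, b', hab'⟩ := hΘ.exists_time_support
  refine ⟨a, fun t ht => ?_⟩
  by_cases hbt : b ≤ t
  · exact hb t hbt
  · exact hab' t fun h => ht ⟨h.1, (not_le.1 hbt).le⟩

/-! #### Iterated spatial derivatives: norms -/

/-- `‖D¹(𝒰[Θ](s))(x)‖ = ‖𝒰[DΘ](s)(x)‖`. [folklore] -/
theorem IsSpaceTimeTestOn.norm_iteratedFDeriv_one_heatDuhamelBack
    (hΘ : IsSpaceTimeTestOn (⊤ : Opens (ℝ × E)) Θ) (hν : 0 < ν) (s : ℝ) (x : E) :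
    ‖iteratedFDeriv ℝ 1 (heatDuhamelBack ν Θ s) x‖ =
      ‖heatDuhamelBack ν (fun t y => fderiv ℝ (Θ t) y) s x‖ := by
  rw [norm_iteratedFDeriv_one, hΘ.fderiv_heatDuhamelBack hν s]

/-- `‖D²(𝒰[Θ](s))(x)‖ = ‖𝒰[D²Θ](s)(x)‖` (nested derivatives of the data). [folklore] -/
theorem IsSpaceTimeTestOn.norm_iteratedFDeriv_two_heatDuhamelBack
    (hΘ : IsSpaceTimeTestOn (⊤ : Opens (ℝ × E)) Θ) (hν : 0 < ν) (s : ℝ) (x : E) :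
    ‖iteratedFDeriv ℝ 2 (heatDuhamelBack ν Θ s) x‖ =
      ‖heatDuhamelBack ν (fun t y => fderiv ℝ (fun z => fderiv ℝ (Θ t) z) y) s x‖ := by
  rw [← norm_iteratedFDeriv_fderiv, hΘ.fderiv_heatDuhamelBack hν s]
  exact hΘ.fderiv_top.norm_iteratedFDeriv_one_heatDuhamelBack hν s x

set_option maxSynthPendingDepth 2 in
/-- `‖D³(𝒰[Θ](s))(x)‖ = ‖𝒰[D³Θ](s)(x)‖` (nested derivatives of the data). [folklore] -/
theorem IsSpaceTimeTestOn.norm_iteratedFDeriv_three_heatDuhamelBack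
    (hΘ : IsSpaceTimeTestOn (⊤ : Opens (ℝ × E)) Θ) (hν : 0 < ν) (s : ℝ) (x : E) :
    ‖iteratedFDeriv ℝ 3 (heatDuhamelBack ν Θ s) x‖ =
      ‖heatDuhamelBack ν (fun t y => fderiv ℝ (fun w => fderiv ℝ (fun z => fderiv ℝ (Θ t) z) w) y) s x‖ := by
  rw [← norm_iteratedFDeriv_fderiv, hΘ.fderiv_heatDuhamelBack hν s]
  exact hΘ.fderiv_top.norm_iteratedFDeriv_two_heatDuhamelBack hν s x

/-! #### `L^r` of time slabs -/

/-- **The Duhamel integral of test data lies in every `L^r` of the slab `(0, T) × E`**,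
`1 ≤ r < ∞`: it is bounded there and has uniformly bounded `L¹` slices. [folklore] -/
theorem IsSpaceTimeTestOn.eLpNorm_heatDuhamelBack_slab_lt_top
    (hΘ : IsSpaceTimeTestOn (⊤ : Opens (ℝ × E)) Θ) (hν : 0 < ν) {r : ℝ≥0∞} (hr1 : 1 ≤ r)
    (hrt : r ≠ ⊤) (T : ℝ) :
    eLpNorm (fun p : ℝ × E => heatDuhamelBack ν Θ p.1 p.2) r
      ((volume.restrict (Ioo 0 T)).prod (volume : Measure E)) < ⊤ := by
  obtain ⟨M, hM0, hM⟩ := hΘ.exists_norm_le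
  obtain ⟨M₁, hM₁0, hM₁⟩ := hΘ.exists_integral_norm_slice_le
  obtain ⟨a, b, hab⟩ := hΘ.exists_time_support
  set μ : Measure (ℝ × E) := (volume.restrict (Ioo 0 T)).prod (volume : Measure E) with hμ
  set U : ℝ × E → F := fun p => heatDuhamelBack ν Θ p.1 p.2 with hU
  set B : ℝ := M * max b 0 with hB
  set B₁ : ℝ := M₁ * max b 0 with hB₁
  have hB0 : 0 ≤ B := by positivity
  -- pointwise and sliced bounds on the slab
  have hmax : ∀ s : ℝ, 0 < s → max (b - s) 0 ≤ max b 0 := fun s hs =>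
    max_le ((sub_le_self b hs.le).trans (le_max_left _ _)) (le_max_right _ _)
  have hbd : ∀ p : ℝ × E, 0 < p.1 → ‖U p‖ ≤ B := fun p hp =>
    (hΘ.norm_heatDuhamelBack_le hν hM hab p.1 p.2).trans (mul_le_mul_of_nonneg_left (hmax p.1 hp) hM0)
  have hsl : ∀ s : ℝ, 0 < s → ∫ x, ‖heatDuhamelBack ν Θ s x‖ ≤ B₁ := fun s hs =>
    (hΘ.integral_norm_heatDuhamelBack_le hν hM₁ hab s).trans (mul_le_mul_of_nonneg_left (hmax s hs) hM₁0)
  have hr0 : r ≠ 0 := (zero_lt_one.trans_le hr1).ne'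
  have hrr : 1 ≤ r.toReal := by
    have := ENNReal.toReal_mono hrt hr1
    simpa using this
  have hUc : Continuous U := hΘ.continuous_heatDuhamelBack hν
  rw [eLpNorm_lt_top_iff_lintegral_rpow_enorm_lt_top hr0 hrt]
  -- `‖U‖ₑ^r ≤ B^{r-1} ‖U‖ₑ` on the slab
  have hpt : ∀ᵐ p ∂μ, ‖U p‖ₑ ^ r.toReal ≤ ENNReal.ofReal (B ^ (r.toReal - 1)) * ‖U p‖ₑ := by
    have hae : ∀ᵐ p ∂μ, p.1 ∈ Ioo 0 T := by
      rw [ae_iff]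
      have hset : {p : ℝ × E | ¬p.1 ∈ Ioo 0 T} = (Ioo 0 T)ᶜ ×ˢ (univ : Set E) := by
        ext p; simp
      rw [hset, hμ, Measure.prod_prod, Measure.restrict_apply measurableSet_Ioo.compl,
        compl_inter_self, measure_empty, zero_mul]
    filter_upwards [hae] with p hp
    have h1 : ‖U p‖ₑ ^ r.toReal = ‖U p‖ₑ ^ (r.toReal - 1) * ‖U p‖ₑ := by
      conv_lhs => rw [show r.toReal = (r.toReal - 1) + 1 by ring]
      rw [ENNReal.rpow_add_of_nonneg _ _ (by linarith) zero_le_one, ENNReal.rpow_one]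
    rw [h1]
    gcongr
    rw [← ofReal_norm, ENNReal.ofReal_rpow_of_nonneg (norm_nonneg _) (by linarith)]
    exact ENNReal.ofReal_le_ofReal (Real.rpow_le_rpow (norm_nonneg _) (hbd p hp.1) (by linarith))
  refine lt_of_le_of_lt (lintegral_mono_ae hpt) ?_
  rw [lintegral_const_mul' _ _ ENNReal.ofReal_ne_top]
  refine ENNReal.mul_lt_top ENNReal.ofReal_lt_top ?_
  -- `∫⁻ ‖U‖ₑ ≤ T · B₁`
  rw [hμ, lintegral_prod _ hUc.aestronglyMeasurable.enorm]
  have hin : ∀ s : ℝ, 0 < s → ∫⁻ x, ‖U (s, x)‖ₑ ≤ ENNReal.ofReal B₁ := fun s hs => by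
    rw [← ofReal_integral_norm_eq_lintegral_enorm (hΘ.integrable_heatDuhamelBack hν s)]
    exact ENNReal.ofReal_le_ofReal (hsl s hs)
  calc ∫⁻ s in Ioo 0 T, ∫⁻ x, ‖U (s, x)‖ₑ ≤ ∫⁻ _s in Ioo 0 T, ENNReal.ofReal B₁ := by
        refine setLIntegral_mono measurable_const fun s hs => hin s hs.1
    _ < ⊤ := by
        rw [setLIntegral_const]
        exact ENNReal.mul_lt_top ENNReal.ofReal_lt_top (by rw [Real.volume_Ioo]; exact ENNReal.ofReal_lt_top)

/-- The slice at time `0` of the Duhamel integral of test data is in `L²(E)`, as a finiteness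
statement. [folklore] -/
theorem IsSpaceTimeTestOn.eLpNorm_heatDuhamelBack_slice_lt_top
    (hΘ : IsSpaceTimeTestOn (⊤ : Opens (ℝ × E)) Θ) (hν : 0 < ν) (s : ℝ) :
    eLpNorm (heatDuhamelBack ν Θ s) 2 (volume : Measure E) < ⊤ :=
  (hΘ.memLp_two_heatDuhamelBack hν s).eLpNorm_lt_top

end Duhamel

/-! ### The time cut-off and the scalar potential `Ψ = ζ · 𝒰[θ]` -/

section TimeCutoff

variable {ν : ℝ} {θ : ℝ → E → ℝ}

omit [MeasurableSpace E] [BorelSpace E] in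
/-- The time cut-off `ζ(t) = smoothTransition (t + 2)` is smooth, `= 1` for `t ≥ -1` and `= 0`
for `t ≤ -2`. [folklore] -/
theorem timeCutoff_props :
    ContDiff ℝ ∞ (fun t : ℝ => Real.smoothTransition (t + 2)) ∧
      (∀ t : ℝ, -1 ≤ t → Real.smoothTransition (t + 2) = 1) ∧
      (∀ t : ℝ, t ≤ -2 → Real.smoothTransition (t + 2) = 0) :=
  ⟨Real.smoothTransition.contDiff.comp (contDiff_id.add contDiff_const),
    fun t ht => Real.smoothTransition.one_of_one_le (by linarith),
    fun t ht => Real.smoothTransition.zero_of_nonpos (by linarith)⟩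

/-- `Ψ = ζ · 𝒰[θ]` is jointly smooth. [folklore] -/
theorem contDiff_uncurry_timeCutoff_mul_heatDuhamelBack
    (hθ : IsSpaceTimeTestOn (⊤ : Opens (ℝ × E)) θ) (hν : 0 < ν) :
    ContDiff ℝ ∞ (uncurry fun t x => Real.smoothTransition (t + 2) * heatDuhamelBack ν θ t x) :=
  (timeCutoff_props.1.comp contDiff_fst).mul (hθ.contDiff_uncurry_heatDuhamelBack_infty hν)

/-- `Ψ = ζ · 𝒰[θ]` vanishes for `t ∉ [-2, b]` if `θ` vanishes for `t ∉ [a, b]`. [folklore] -/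
theorem timeCutoff_mul_heatDuhamelBack_eq_zero
    (hθ : IsSpaceTimeTestOn (⊤ : Opens (ℝ × E)) θ) (hν : 0 < ν) {a b : ℝ}
    (hab : ∀ t, t ∉ Icc a b → θ t = 0) (t : ℝ) (ht : t ∉ Icc (-2) b) :
    (fun x => Real.smoothTransition (t + 2) * heatDuhamelBack ν θ t x) = 0 := by
  funext x
  rw [Pi.zero_apply]
  rcases lt_or_ge t (-2) with h | h
  · rw [timeCutoff_props.2.2 t h.le, zero_mul]
  · have hbt : b ≤ t := by
      by_contra hbt
      exact ht ⟨h, (not_le.1 hbt).le⟩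
    rw [hθ.heatDuhamelBack_eq_zero_of_le hν hab hbt x, mul_zero]

/-- For `t ≥ -1` the slice of `Ψ` is the slice of `𝒰[θ]`. [folklore] -/
theorem timeCutoff_mul_heatDuhamelBack_slice {t : ℝ} (ht : -1 ≤ t) :
    (fun x => Real.smoothTransition (t + 2) * heatDuhamelBack ν θ t x) = heatDuhamelBack ν θ t := by
  funext x
  rw [timeCutoff_props.2.1 t ht, one_mul]

/-- For `t > -1` the time derivative of `Ψ` is `𝒰[∂ₜθ](t)`. [folklore] -/
theorem timeDeriv_timeCutoff_mul_heatDuhamelBack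
    (hθ : IsSpaceTimeTestOn (⊤ : Opens (ℝ × E)) θ) (hν : 0 < ν) {t : ℝ} (ht : -1 < t) :
    timeDeriv (fun t x => Real.smoothTransition (t + 2) * heatDuhamelBack ν θ t x) t =
      heatDuhamelBack ν (timeDeriv θ) t := by
  funext x
  rw [timeDeriv_apply]
  have hev : (fun s => Real.smoothTransition (s + 2) * heatDuhamelBack ν θ s x) =ᶠ[𝓝 t]
      fun s => heatDuhamelBack ν θ s x := by
    filter_upwards [Ioi_mem_nhds ht] with s hs
    rw [timeCutoff_props.2.1 s (le_of_lt hs), one_mul]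
  rw [hev.deriv_eq]
  exact hθ.deriv_heatDuhamelBack_time hν t x

omit [CompleteSpace F] in
/-- The same for a vector-valued datum: for `t > -1`, `∂ₜ(ζ • 𝒰[Φ])(t) = 𝒰[∂ₜΦ](t)`. [folklore] -/
theorem timeDeriv_timeCutoff_smul_heatDuhamelBack {Φ : ℝ → E → F}
    (hΦ : IsSpaceTimeTestOn (⊤ : Opens (ℝ × E)) Φ) (hν : 0 < ν) {t : ℝ} (ht : -1 < t) :
    timeDeriv (fun t x => Real.smoothTransition (t + 2) • heatDuhamelBack ν Φ t x) t =
      heatDuhamelBack ν (timeDeriv Φ) t := by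
  funext x
  rw [timeDeriv_apply]
  have hev : (fun s => Real.smoothTransition (s + 2) • heatDuhamelBack ν Φ s x) =ᶠ[𝓝 t]
      fun s => heatDuhamelBack ν Φ s x := by
    filter_upwards [Ioi_mem_nhds ht] with s hs
    rw [timeCutoff_props.2.1 s (le_of_lt hs), one_smul]
  rw [hev.deriv_eq]
  exact hΦ.deriv_heatDuhamelBack_time hν t x

omit [CompleteSpace F] in
/-- For `t ≥ -1` the slice of `ζ • 𝒰[Φ]` is the slice of `𝒰[Φ]`. [folklore] -/
theorem timeCutoff_smul_heatDuhamelBack_slice {Φ : ℝ → E → F} {t : ℝ} (ht : -1 ≤ t) :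
    (fun x => Real.smoothTransition (t + 2) • heatDuhamelBack ν Φ t x) = heatDuhamelBack ν Φ t := by
  funext x
  rw [timeCutoff_props.2.1 t ht, one_smul]

end TimeCutoff

/-! ### Slab tools -/

section SlabTools

/-- Almost every point of the slab measure `(vol|_(0,T)) × vol` has its time in `(0, T)`. [folklore] -/
theorem ae_fst_mem_Ioo_slab (T : ℝ) :
    ∀ᵐ p ∂((volume.restrict (Ioo 0 T)).prod (volume : Measure E)), p.1 ∈ Ioo 0 T := by
  rw [ae_iff]
  have hset : {p : ℝ × E | ¬p.1 ∈ Ioo 0 T} = (Ioo 0 T)ᶜ ×ˢ (univ : Set E) := by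
    ext p; simp
  rw [hset, Measure.prod_prod, Measure.restrict_apply measurableSet_Ioo.compl, compl_inter_self,
    measure_empty, zero_mul]

/-- The slab measure is dominated by the volume of `ℝ × E`. [folklore] -/
theorem slab_le_volume (T : ℝ) :
    (volume.restrict (Ioo 0 T)).prod (volume : Measure E) ≤ (volume : Measure (ℝ × E)) := by
  rw [Measure.volume_eq_prod, Measure.restrict_prod_eq_prod_univ]
  exact Measure.restrict_le_self

/-- The exponent `4/3`: `1 ≤ 4/3 < ∞` in `ℝ≥0∞`. [folklore] -/
theorem one_le_four_thirds_and_ne_top : (1 : ℝ≥0∞) ≤ 4 / 3 ∧ (4 / 3 : ℝ≥0∞) ≠ ⊤ := by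
  refine ⟨?_, ENNReal.div_ne_top (by norm_num) (by norm_num)⟩
  rw [ENNReal.le_div_iff_mul_le (Or.inl (by norm_num)) (Or.inl (by norm_num))]; norm_num

omit [CompleteSpace F] in
/-- A space–time test field lies in every `L^r` of the slab. [folklore] -/
theorem IsSpaceTimeTestOn.memLp_slab {Θ : ℝ → E → F} (hΘ : IsSpaceTimeTestOn (⊤ : Opens (ℝ × E)) Θ)
    (r : ℝ≥0∞) (T : ℝ) {Θ' : ℝ × E → F} (hΘ' : ∀ p, Θ' p = Θ p.1 p.2) :
    MemLp Θ' r ((volume.restrict (Ioo 0 T)).prod (volume : Measure E)) := by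
  obtain rfl : Θ' = uncurry Θ := funext fun p => hΘ' p
  exact (hΘ.contDiff.continuous.memLp_of_hasCompactSupport hΘ.hasCompactSupport).mono_measure
    (slab_le_volume T)

/-- `⟪V, 𝒰[Θ]⟫` is integrable on the slab for `V ∈ L⁴` of the slab. [folklore] -/
theorem IsSpaceTimeTestOn.integrable_inner_heatDuhamelBack_slab {ν : ℝ} {Θ : ℝ → E → E}
    (hΘ : IsSpaceTimeTestOn (⊤ : Opens (ℝ × E)) Θ) (hν : 0 < ν) {T : ℝ} {V : ℝ × E → E}
    (hV4 : MemLp V 4 ((volume.restrict (Ioo 0 T)).prod (volume : Measure E))) :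
    Integrable (fun p : ℝ × E => ⟪V p, heatDuhamelBack ν Θ p.1 p.2⟫)
      ((volume.restrict (Ioo 0 T)).prod (volume : Measure E)) := by
  have hU : MemLp (fun p : ℝ × E => heatDuhamelBack ν Θ p.1 p.2) (4 / 3)
      ((volume.restrict (Ioo 0 T)).prod (volume : Measure E)) :=
    ⟨(hΘ.continuous_heatDuhamelBack hν).aestronglyMeasurable,
      hΘ.eLpNorm_heatDuhamelBack_slab_lt_top hν one_le_four_thirds_and_ne_top.1
        one_le_four_thirds_and_ne_top.2 T⟩
  refine (integrable_norm_mul_of_four_fourThirds hV4 hU.norm).mono'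
    (hV4.1.inner (hΘ.continuous_heatDuhamelBack hν).aestronglyMeasurable)
    (Eventually.of_forall fun p => norm_inner_le_norm _ _)

end SlabTools

/-! ### The vorticity-duality identity -/

section Identity

variable {ν T : ℝ} {v₀ : E → E} {v : ℝ → E → E} {θ : ℝ → E → ℝ}

/-- **The vorticity-duality identity** (Galdi 2019, proof of Thm. 1.1, the duality identity
(2.12), here with the adjoint *heat* flow in place of the adjoint Oseen problem). Let `ν > 0`,
let `v` be a distributional (pressure-free, divergence-free-tested) solution of the unforced
Navier–Stokes system on `E × [0,T)` with datum `v₀ ∈ L²` (accepted `Fluid.IsWeakNSSolutionOn`)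
lying in `L⁴` of the slab `(0,T) × E`, let `θ` be a scalar space–time test function with
`θ(t) = 0` for `t ≥ b`, some `b < T`, let `a, c ∈ E`, `Φ = (∂ₐθ) c - (∂_cθ) a` (the
curl-type field of `θ`) and `U = 𝒰[Φ]` the backward caloric Duhamel integral of `Φ`
(`∂ₛU + νΔU = -Φ`, `U(s) = 0` for `s ≥ b`, `div U = 0`). Then
`∫_{(0,T)×E} ⟪v, Φ⟫ = ∫_{(0,T)×E} ⟪v, (v·∇)U⟫ + ∫ ⟪v₀, U(0)⟫`.
Proof: `U(t) = (∂ₐ𝒰[θ](t)) c - (∂_c𝒰[θ](t)) a` is a curl-type field of the smooth scalar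
`𝒰[θ]`, whose derivatives are Duhamel integrals of test data and hence in every `L^r` of the
slab; after a time cut-off below `t = -1` the extension theorem
`IsWeakNSSolutionOn.weakForm_curlPair_extended_prod` applies, and `∂ₜU + νΔU = -Φ` on the slab.
Since `v` is divergence free the left-hand side only sees the vorticity `∂ₐv_c - ∂_cv_a` of `v`
paired with `θ`, whence the name. [cite: Galdi2018, proof of Thm. 1.1, (2.12)] -/
theorem IsWeakNSSolutionOn.integral_inner_curlPair_eq (hν : 0 < ν)
    (hw : IsWeakNSSolutionOn T ν 0 v₀ v) (hv₀ : MemLp v₀ 2 volume)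
    (hv4 : eLpNorm (uncurry v) 4 ((volume.restrict (Ioo 0 T)).prod (volume : Measure E)) < ⊤)
    (hθ : IsSpaceTimeTestOn (⊤ : Opens (ℝ × E)) θ) {b : ℝ} (hbT : b < T)
    (hb : ∀ t, b ≤ t → θ t = 0) (a c : E) {Φ : ℝ → E → E}
    (hΦ : ∀ t x, Φ t x = (fderiv ℝ (θ t) x a) • c - (fderiv ℝ (θ t) x c) • a) :
    ∫ p, ⟪v p.1 p.2, Φ p.1 p.2⟫ ∂((volume.restrict (Ioo 0 T)).prod (volume : Measure E)) =
      (∫ p, ⟪v p.1 p.2, fderiv ℝ (heatDuhamelBack ν Φ p.1) p.2 (v p.1 p.2)⟫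
          ∂((volume.restrict (Ioo 0 T)).prod (volume : Measure E))) +
        ∫ x, ⟪v₀ x, heatDuhamelBack ν Φ 0 x⟫ := by
  -- ### the data
  obtain rfl : Φ = fun t x => 𝐋[a, c] (fderiv ℝ (θ t) x) := by
    funext t x; rw [hΦ]; simp
  set μ : Measure (ℝ × E) := (volume.restrict (Ioo 0 T)).prod (volume : Measure E) with hμ
  have hθ₁ : IsSpaceTimeTestOn (⊤ : Opens (ℝ × E)) (fun t x => fderiv ℝ (θ t) x) := hθ.fderiv_top
  have hΦt : IsSpaceTimeTestOn (⊤ : Opens (ℝ × E)) (fun t x => 𝐋[a, c] (fderiv ℝ (θ t) x)) :=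
    hθ₁.clm_apply_top 𝐋[a, c]
  obtain ⟨a₀, hab⟩ := hθ.exists_time_support_of_le hb
  -- ### the fields `U = 𝒰[Φ]`, `Ψ = ζ 𝒰[θ]`, `ψ = ζ U`
  set U : ℝ → E → E := heatDuhamelBack ν (fun t x => 𝐋[a, c] (fderiv ℝ (θ t) x)) with hU_def
  set Ψ : ℝ → E → ℝ := fun t x => Real.smoothTransition (t + 2) * heatDuhamelBack ν θ t x with hΨ_def
  set ψ : ℝ → E → E := fun t x => Real.smoothTransition (t + 2) • U t x with hψ_def
  have hUeq : ∀ t x, U t x = 𝐋[a, c] (heatDuhamelBack ν (fun t y => fderiv ℝ (θ t) y) t x) :=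
    fun t x => hθ₁.heatDuhamelBack_clm_apply hν 𝐋[a, c] t x
  have hψ : ∀ t x, ψ t x = (fderiv ℝ (Ψ t) x a) • c - (fderiv ℝ (Ψ t) x c) • a := by
    intro t x
    have hd : fderiv ℝ (Ψ t) x =
        Real.smoothTransition (t + 2) • fderiv ℝ (heatDuhamelBack ν θ t) x :=
      fderiv_const_mul ((hθ.differentiable_heatDuhamelBack hν t) x) _
    rw [hd, hθ.fderiv_heatDuhamelBack hν t]
    simp only [hψ_def, hUeq, curlPairCLM_apply, FunLike.coe_smul, Pi.smul_apply,
      smul_eq_mul, smul_sub, smul_smul]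
  -- ### hypotheses of the extension theorem
  have hΨs : ContDiff ℝ ∞ (uncurry Ψ) := contDiff_uncurry_timeCutoff_mul_heatDuhamelBack hθ hν
  have hsupp : ∀ t, t ∉ Icc (-2 : ℝ) b → Ψ t = 0 := fun t ht =>
    timeCutoff_mul_heatDuhamelBack_eq_zero hθ hν hab t ht
  have hae := ae_fst_mem_Ioo_slab (E := E) T
  -- spatial derivatives on the slab
  have hslice : ∀ t : ℝ, 0 < t → Ψ t = heatDuhamelBack ν θ t := fun t ht =>
    timeCutoff_mul_heatDuhamelBack_slice (by linarith)
  have h43 : ∀ k ≤ 3, eLpNorm (fun p : ℝ × E => iteratedFDeriv ℝ k (Ψ p.1) p.2) (4 / 3) μ < ⊤ := by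
    obtain ⟨h43', h43t⟩ := one_le_four_thirds_and_ne_top
    intro k hk
    interval_cases k
    · refine lt_of_le_of_lt (le_of_eq (eLpNorm_congr_norm_ae ?_))
        (hθ.eLpNorm_heatDuhamelBack_slab_lt_top hν h43' h43t T)
      filter_upwards [hae] with p hp
      rw [norm_iteratedFDeriv_zero, hslice p.1 hp.1]
    · refine lt_of_le_of_lt (le_of_eq (eLpNorm_congr_norm_ae ?_))
        (hθ₁.eLpNorm_heatDuhamelBack_slab_lt_top hν h43' h43t T)
      filter_upwards [hae] with p hp
      rw [hslice p.1 hp.1, hθ.norm_iteratedFDeriv_one_heatDuhamelBack hν]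
    · refine lt_of_le_of_lt (le_of_eq (eLpNorm_congr_norm_ae ?_))
        (hθ₁.fderiv_top.eLpNorm_heatDuhamelBack_slab_lt_top hν h43' h43t T)
      filter_upwards [hae] with p hp
      rw [hslice p.1 hp.1, hθ.norm_iteratedFDeriv_two_heatDuhamelBack hν]
    · refine lt_of_le_of_lt (le_of_eq (eLpNorm_congr_norm_ae ?_))
        (hθ₁.fderiv_top.fderiv_top.eLpNorm_heatDuhamelBack_slab_lt_top hν h43' h43t T)
      filter_upwards [hae] with p hp
      rw [hslice p.1 hp.1, hθ.norm_iteratedFDeriv_three_heatDuhamelBack hν]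
  have h2 : ∀ k ≤ 2, eLpNorm (fun p : ℝ × E => iteratedFDeriv ℝ k (Ψ p.1) p.2) 2 μ < ⊤ := by
    intro k hk
    interval_cases k
    · refine lt_of_le_of_lt (le_of_eq (eLpNorm_congr_norm_ae ?_))
        (hθ.eLpNorm_heatDuhamelBack_slab_lt_top hν one_le_two ENNReal.ofNat_ne_top T)
      filter_upwards [hae] with p hp
      rw [norm_iteratedFDeriv_zero, hslice p.1 hp.1]
    · refine lt_of_le_of_lt (le_of_eq (eLpNorm_congr_norm_ae ?_))
        (hθ₁.eLpNorm_heatDuhamelBack_slab_lt_top hν one_le_two ENNReal.ofNat_ne_top T)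
      filter_upwards [hae] with p hp
      rw [hslice p.1 hp.1, hθ.norm_iteratedFDeriv_one_heatDuhamelBack hν]
    · refine lt_of_le_of_lt (le_of_eq (eLpNorm_congr_norm_ae ?_))
        (hθ₁.fderiv_top.eLpNorm_heatDuhamelBack_slab_lt_top hν one_le_two ENNReal.ofNat_ne_top T)
      filter_upwards [hae] with p hp
      rw [hslice p.1 hp.1, hθ.norm_iteratedFDeriv_two_heatDuhamelBack hν]
  -- time derivative on the slab
  have htslice : ∀ t : ℝ, 0 < t → timeDeriv Ψ t = heatDuhamelBack ν (timeDeriv θ) t := fun t ht =>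
    timeDeriv_timeCutoff_mul_heatDuhamelBack hθ hν (by linarith)
  have hθt : IsSpaceTimeTestOn (⊤ : Opens (ℝ × E)) (timeDeriv θ) := hθ.timeDeriv_top
  have ht43 : ∀ k ≤ 1, eLpNorm (fun p : ℝ × E => iteratedFDeriv ℝ k (timeDeriv Ψ p.1) p.2) (4 / 3) μ
      < ⊤ := by
    obtain ⟨h43', h43t⟩ := one_le_four_thirds_and_ne_top
    intro k hk
    interval_cases k
    · refine lt_of_le_of_lt (le_of_eq (eLpNorm_congr_norm_ae ?_))
        (hθt.eLpNorm_heatDuhamelBack_slab_lt_top hν h43' h43t T)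
      filter_upwards [hae] with p hp
      rw [norm_iteratedFDeriv_zero, htslice p.1 hp.1]
    · refine lt_of_le_of_lt (le_of_eq (eLpNorm_congr_norm_ae ?_))
        (hθt.fderiv_top.eLpNorm_heatDuhamelBack_slab_lt_top hν h43' h43t T)
      filter_upwards [hae] with p hp
      rw [htslice p.1 hp.1, hθt.norm_iteratedFDeriv_one_heatDuhamelBack hν]
  -- the slice at `t = 0`
  have hΨ0 : Ψ 0 = heatDuhamelBack ν θ 0 := timeCutoff_mul_heatDuhamelBack_slice (by norm_num)
  have h0 : ∀ k ≤ 1, eLpNorm (fun x => iteratedFDeriv ℝ k (Ψ 0) x) 2 (volume : Measure E) < ⊤ := by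
    intro k hk
    interval_cases k
    · refine lt_of_le_of_lt (le_of_eq (eLpNorm_congr_norm_ae (Eventually.of_forall fun x => ?_)))
        (hθ.eLpNorm_heatDuhamelBack_slice_lt_top hν 0)
      rw [norm_iteratedFDeriv_zero, hΨ0]
    · refine lt_of_le_of_lt (le_of_eq (eLpNorm_congr_norm_ae (Eventually.of_forall fun x => ?_)))
        (hθ₁.eLpNorm_heatDuhamelBack_slice_lt_top hν 0)
      rw [hΨ0, hθ.norm_iteratedFDeriv_one_heatDuhamelBack hν]
  -- ### the extended weak formulation
  have hmain := hw.weakForm_curlPair_extended_prod hv₀ hv4 hΨs hbT hsupp h43 h2 ht43 h0 a c hψ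
  -- ### identification of the terms on the slab
  have hψslice : ∀ t : ℝ, 0 ≤ t → ψ t = U t := fun t ht =>
    timeCutoff_smul_heatDuhamelBack_slice (by linarith)
  have hψt : ∀ t : ℝ, 0 < t → timeDeriv ψ t =
      heatDuhamelBack ν (timeDeriv fun t x => 𝐋[a, c] (fderiv ℝ (θ t) x)) t := fun t ht =>
    timeDeriv_timeCutoff_smul_heatDuhamelBack hΦt hν (by linarith)
  have hV4 : MemLp (uncurry v) 4 μ := ⟨aestronglyMeasurable_uncurry_prod_of_restrict hw.1, hv4⟩
  -- integrability of the pairings with `𝒰[∂ₜΦ]`, `𝒰[ΔΦ]`, `Φ`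
  have iT := hΦt.timeDeriv_top.integrable_inner_heatDuhamelBack_slab hν hV4
  have iL := hΦt.laplacian_top.integrable_inner_heatDuhamelBack_slab hν hV4
  have iΦ : Integrable (fun p : ℝ × E => ⟪uncurry v p, 𝐋[a, c] (fderiv ℝ (θ p.1) p.2)⟫) μ := by
    have hm : MemLp (fun p : ℝ × E => 𝐋[a, c] (fderiv ℝ (θ p.1) p.2)) (4 / 3) μ :=
      hΦt.memLp_slab (4 / 3) T (fun _ => rfl)
    exact (integrable_norm_mul_of_four_fourThirds hV4 hm.norm).mono'
      (hV4.1.inner hΦt.contDiff.continuous.aestronglyMeasurable)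
      (Eventually.of_forall fun p => norm_inner_le_norm _ _)
  -- rewrite the four terms
  have e1 : ∫ p, ⟪v p.1 p.2, timeDeriv ψ p.1 p.2⟫ ∂μ =
      ∫ p, ⟪uncurry v p, heatDuhamelBack ν (timeDeriv fun t x => 𝐋[a, c] (fderiv ℝ (θ t) x))
        p.1 p.2⟫ ∂μ := by
    refine integral_congr_ae ?_
    filter_upwards [hae] with p hp
    rw [hψt p.1 hp.1]
    rfl
  have e3 : ∫ p, ⟪v p.1 p.2, Δ (ψ p.1) p.2⟫ ∂μ =
      ∫ p, ⟪uncurry v p, heatDuhamelBack ν (fun t => Δ (fun x => 𝐋[a, c] (fderiv ℝ (θ t) x)))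
        p.1 p.2⟫ ∂μ := by
    refine integral_congr_ae ?_
    filter_upwards [hae] with p hp
    rw [hψslice p.1 hp.1.le, hU_def, hΦt.laplacian_heatDuhamelBack hν p.1 p.2]
    rfl
  have e2 : ∫ p, ⟪v p.1 p.2, fderiv ℝ (ψ p.1) p.2 (v p.1 p.2)⟫ ∂μ =
      ∫ p, ⟪v p.1 p.2, fderiv ℝ (U p.1) p.2 (v p.1 p.2)⟫ ∂μ := by
    refine integral_congr_ae ?_
    filter_upwards [hae] with p hp
    rw [hψslice p.1 hp.1.le]
  have e0 : ∫ x, ⟪v₀ x, ψ 0 x⟫ = ∫ x, ⟪v₀ x, U 0 x⟫ := by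
    rw [hψslice 0 le_rfl]
  -- the backward heat equation
  have ePDE : (∫ p, ⟪uncurry v p, heatDuhamelBack ν (timeDeriv fun t x => 𝐋[a, c] (fderiv ℝ (θ t) x))
        p.1 p.2⟫ ∂μ) + ν * ∫ p, ⟪uncurry v p, heatDuhamelBack ν
          (fun t => Δ (fun x => 𝐋[a, c] (fderiv ℝ (θ t) x))) p.1 p.2⟫ ∂μ =
      -∫ p, ⟪uncurry v p, 𝐋[a, c] (fderiv ℝ (θ p.1) p.2)⟫ ∂μ := by
    rw [← integral_const_mul, ← integral_add iT (iL.const_mul ν), ← integral_neg]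
    refine integral_congr_ae (Eventually.of_forall fun p => ?_)
    dsimp only
    rw [← real_inner_smul_right, ← inner_add_right, ← inner_neg_right,
      hΦt.heatDuhamelBack_backward_heat hν p.1 p.2]
  -- ### conclusion
  rw [e1, e2, e3, e0] at hmain
  have : ∫ p, ⟪v p.1 p.2, 𝐋[a, c] (fderiv ℝ (θ p.1) p.2)⟫ ∂μ =
      ∫ p, ⟪uncurry v p, 𝐋[a, c] (fderiv ℝ (θ p.1) p.2)⟫ ∂μ := rfl
  rw [this]
  linarith

end Identity



end Literature.Analysis.FluidPDE
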